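import Summits.HubbardSuperconductivity.HubbardSuperconductivity.Theorems.AnisotropyChordTransferFibre3FinXBDisc
import Summits.HubbardSuperconductivity.HubbardSuperconductivity.Theorems.AnisotropyChordTransferFibre3N1FromPieces
import Summits.HubbardSuperconductivity.HubbardSuperconductivity.Theorems.AnisotropyChordTransferFibre3TplusBracket
import Summits.HubbardSuperconductivity.HubbardSuperconductivity.Theorems.AnisotropyChordTransferFibre3OneLoopCross

/-!
# Route `AnisotropyChord` / H0 rotor rung: FIN small-`L` EXACT-BLOCK certificate — the objects and the row-`N₁` crux on a cell

Soundness layer 3 of `…Fibre3FinXBEval`: the five object brackets and the cell certificate.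
* ★ `mem_objB` (`B`, p1 `btermOneLoop_holds`), `mem_objP` (`‖Π⁰‖²`, `piNormOneLoop_holds`), `mem_objA` (`A(x̂)`,
  `axhatOneLoop_holds`), `mem_objQ` (`⟨Π⁰,C0⟩`, `piC0OneLoop_holds`), `mem_objC` (`B_C`, `bcOneLoop_holds`) — each one-loop sum
  over all momenta against the tables of layers 1–2 (`mem_fAt`, `disc_sound`, `mem_n2Of`, `mem_crossOf`);
* `n1Lo_le` (the fixed-point `N₁⁻` is below p1's `n1_ge_pieces` expression at the bracket ends), `tplus_le_tPlusHi`
  (p1 `Tplus_bracket`);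
* ★★ `xb_cell_sound : 5 ≤ L → 0 ≤ Δ < 1 → IsGroundTwoMagnon L Δ λ₂ f → λ₂·D ∈ [la, lb] → xbCellOK L la lb cmin = true →
  cmin · Uunit L Δ f ≤ trialGapN1 L Δ f` — the row-`N₁` crux `TrialGapAbs` restricted to the ground profiles of ONE λ-cell,
  by kernel computation with zero data (`decide` on `xbCellOK`, per-cell files `…FinXBL<L><part>`).
Prover seat `hubbard-h0-rotor-p3` g5; helper for piece A = stmt-HubbardSuperconductivity-23918 of rung 19089 (`--supports`, helper
class).  WHAT THIS IS NOT: nothing here proves superconductivity in the Hubbard model (rotor TARGET as worded stays FALSE, g15 verdict);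
one hypothesis (the `N₁` row, per `L`, per cell) of ONE conditional reduction.  Tree imports only; no sorry, no new axioms.
-/

set_option linter.dupNamespace false
set_option autoImplicit false

namespace Summit.HubbardSuperconductivity.HubbardSuperconductivity.Theorems.AnisotropyChord.Transfer.Fibre3

namespace FinXB

open scoped BigOperators
open Finset Hole2 FinCell

variable (L : ℕ) [NeZero L]

/-! ## Momentum bookkeeping -/

omit [NeZero L] in
/-- the `x̂`-shift of a natural momentum. [folklore] -/
theorem natPair_add_K1 (k1 k2 : ℕ) :
    ((((k1 : ℕ) : ZMod L), ((k2 : ℕ) : ZMod L)) : Tor L) + K1 L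
      = (((((k1 + 1) % L : ℕ)) : ZMod L), ((k2 : ℕ) : ZMod L)) := by
  unfold K1
  refine Prod.ext ?_ ?_
  · simp only [Prod.fst_add, ZMod.natCast_mod]; push_cast; ring
  · simp

variable {L}

/-- common hypotheses of the cell lemmas, bundled. -/
structure CellHyp (Δ lam2 : ℝ) (f : Tor L → ℝ) (la lb : ℤ) : Prop where
  /-- `5 ≤ L` -/
  hL : 5 ≤ L
  /-- `0 ≤ Δ` -/
  hΔ0 : 0 ≤ Δ
  /-- `Δ < 1` -/
  hΔ1 : Δ < 1
  /-- the ground profile -/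
  hf : IsGroundTwoMagnon L Δ lam2 f
  /-- cell lower end -/
  hla : (la : ℝ) ≤ lam2 * ((D : ℤ) : ℝ)
  /-- cell upper end -/
  hlb : lam2 * ((D : ℤ) : ℝ) ≤ (lb : ℝ)
  /-- g4's ground-cell check -/
  hchk : groundCellCheck L la lb = true
  /-- `1 − Δ > 0` on the cell -/
  hsc : xbScalOK L la lb = true

namespace CellHyp

variable {Δ lam2 : ℝ} {f : Tor L → ℝ} {la lb : ℤ} (H : CellHyp (L := L) Δ lam2 f la lb)
include H

/-- `3 ≤ L`. [folklore] -/
theorem hL3 : 3 ≤ L := by have := H.hL; omega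
/-- `0 < λ₂`. [folklore] -/
theorem hlam : 0 < lam2 := lam2_pos L H.hL3 H.hΔ1 H.hf.1
/-- the momentum positivity check. [folklore] -/
theorem hpos : denCellPos L (cosTab L) la lb = true := (groundCellCheck_spec H.hchk).1
/-- the ground profile is even. [folklore] -/
theorem hev : ∀ r : Tor L, f (-r) = f r := H.hf.2.1
/-- the cell scalars are enclosed. [folklore] -/
theorem hS : ScalOK L Δ lam2 f (xbScal L la lb (gresCellTab L (cosTab L) la lb)) :=
  scal_sound L H.hL H.hΔ0 H.hΔ1 H.hf H.hla H.hlb H.hchk H.hsc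

/-- `F₂` from the table. [folklore] -/
theorem memF {k1 k2 : ℕ} (hk1 : k1 < L) (hk2 : k2 < L) :
    mem (F2 L f ((((k1 : ℕ) : ZMod L), ((k2 : ℕ) : ZMod L))))
      (getF (fTabX L (xbScal L la lb (gresCellTab L (cosTab L) la lb)) (gresCellTab L (cosTab L) la lb)
        (tTab L (gresCellTab L (cosTab L) la lb))) k1 k2) := by
  unfold fTabX
  rw [getF_mkTab _ hk1 hk2]
  exact mem_fAt L H.hL H.hΔ0 H.hf H.hla H.hlb H.hpos H.hS H.hlam hk1 hk2

/-- the disc of `φ̂_e(k)`. [folklore] -/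
theorem discOK {j : ℕ} (hj : j < 4) {k1 k2 : ℕ} (hk1 : k1 < L) (hk2 : k2 < L) :
    DiscOK (phiHat L f (eDir L j) ((((k1 : ℕ) : ZMod L), ((k2 : ℕ) : ZMod L))))
      (disc L (xbScal L la lb (gresCellTab L (cosTab L) la lb)) (gresCellTab L (cosTab L) la lb)
        (tTab L (gresCellTab L (cosTab L) la lb)) (cosTab L) (cosTab (4 * L)) j k1 k2) :=
  disc_sound L H.hL H.hΔ0 H.hf H.hlam H.hla H.hlb H.hpos H.hS hj hk1 hk2

/-! ## The objects -/

/-- ★ `B ∈ O.B`. [folklore] -/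
theorem mem_objB : mem (Bterm L f) (xbEval L la lb).2.B := by
  have hL0 : 0 < L := by have := H.hL; omega
  show mem (Bterm L f) (idivn (iscale 6 (sumF2Fx L (fTabX L (xbScal L la lb (gresCellTab L (cosTab L) la lb)) (gresCellTab L (cosTab L) la lb) (tTab L (gresCellTab L (cosTab L) la lb))))) ((L : ℤ) * L))
  rw [btermOneLoop_holds L f H.hev, sum_tor_range]
  have hLL : (0 : ℤ) < (L : ℤ) * L := by
    have : (0 : ℤ) < L := by exact_mod_cast hL0
    positivity
  have hs : mem (∑ i ∈ range L, ∑ j ∈ range L,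
      F2 L f ((((i : ℕ) : ZMod L), ((j : ℕ) : ZMod L))) ^ 2
        * F2 L f (((((i : ℕ) : ZMod L), ((j : ℕ) : ZMod L)) : Tor L) + K1 L)) (sumF2Fx L (fTabX L (xbScal L la lb (gresCellTab L (cosTab L) la lb)) (gresCellTab L (cosTab L) la lb) (tTab L (gresCellTab L (cosTab L) la lb)))) := by
    unfold sumF2Fx
    refine mem_psum _ _ L fun k1 hk1 => mem_psum _ _ L fun k2 hk2 => ?_
    rw [natPair_add_K1, sq]
    exact mem_imul (mem_imul (H.memF hk1 hk2) (H.memF hk1 hk2)) (H.memF (Nat.mod_lt _ hL0) hk2)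
  have h := mem_idivn (mem_iscale 6 hs) hLL
  have e : ∀ x : ℝ, ((6 : ℕ) : ℝ) * x / ((((L : ℤ) * L : ℤ)) : ℝ) = 6 * x / (L : ℝ) ^ 2 := by
    intro x; push_cast; ring
  rw [e] at h
  exact h

/-- ★ `‖Π⁰‖² ∈ O.P`. [folklore] -/
theorem mem_objP : mem (PiNormSq L f) (xbEval L la lb).2.P := by
  have hL0 : 0 < L := by have := H.hL; omega
  show mem (PiNormSq L f) (idivn (sumF3 L (fTabX L (xbScal L la lb (gresCellTab L (cosTab L) la lb)) (gresCellTab L (cosTab L) la lb) (tTab L (gresCellTab L (cosTab L) la lb)))) ((L : ℤ) * L))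
  rw [piNormOneLoop_holds L f H.hev, sum_tor_range]
  have hLL : (0 : ℤ) < (L : ℤ) * L := by
    have : (0 : ℤ) < L := by exact_mod_cast hL0
    positivity
  have hs : mem (∑ i ∈ range L, ∑ j ∈ range L, F2 L f ((((i : ℕ) : ZMod L), ((j : ℕ) : ZMod L))) ^ 3)
      (sumF3 L (fTabX L (xbScal L la lb (gresCellTab L (cosTab L) la lb)) (gresCellTab L (cosTab L) la lb) (tTab L (gresCellTab L (cosTab L) la lb)))) := by
    unfold sumF3
    refine mem_psum _ _ L fun k1 hk1 => mem_psum _ _ L fun k2 hk2 => ?_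
    have e : F2 L f ((((k1 : ℕ) : ZMod L), ((k2 : ℕ) : ZMod L))) ^ 3
        = F2 L f ((((k1 : ℕ) : ZMod L), ((k2 : ℕ) : ZMod L))) * F2 L f ((((k1 : ℕ) : ZMod L), ((k2 : ℕ) : ZMod L)))
          * F2 L f ((((k1 : ℕ) : ZMod L), ((k2 : ℕ) : ZMod L))) := by ring
    rw [e]
    exact mem_imul (mem_imul (H.memF hk1 hk2) (H.memF hk1 hk2)) (H.memF hk1 hk2)
  have h := mem_idivn hs hLL
  have e : ∀ x : ℝ, x / ((((L : ℤ) * L : ℤ)) : ℝ) = x / (L : ℝ) ^ 2 := by intro x; push_cast; ring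
  rw [e] at h
  exact h

/-- ★ `A(x̂) ∈ O.A`. [folklore] -/
theorem mem_objA : mem (Axhat L f) (xbEval L la lb).2.A := by
  have hL0 : 0 < L := by have := H.hL; omega
  show mem (Axhat L f) (idivn (sumF2cos L (fTabX L (xbScal L la lb (gresCellTab L (cosTab L) la lb)) (gresCellTab L (cosTab L) la lb) (tTab L (gresCellTab L (cosTab L) la lb))) (cosTab L)) ((L : ℤ) * L))
  rw [axhatOneLoop_holds L f H.hev, sum_tor_range]
  have hLL : (0 : ℤ) < (L : ℤ) * L := by
    have : (0 : ℤ) < L := by exact_mod_cast hL0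
    positivity
  have hs : mem (∑ i ∈ range L, ∑ j ∈ range L,
      F2 L f ((((i : ℕ) : ZMod L), ((j : ℕ) : ZMod L))) ^ 2
        * Real.cos (2 * Real.pi * ((((i : ℕ) : ZMod L), ((j : ℕ) : ZMod L)) : Tor L).1.val / L))
      (sumF2cos L (fTabX L (xbScal L la lb (gresCellTab L (cosTab L) la lb)) (gresCellTab L (cosTab L) la lb) (tTab L (gresCellTab L (cosTab L) la lb))) (cosTab L)) := by
    unfold sumF2cos
    refine mem_psum _ _ L fun k1 hk1 => mem_psum _ _ L fun k2 hk2 => ?_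
    have hv : ((((k1 : ℕ) : ZMod L), ((k2 : ℕ) : ZMod L)) : Tor L).1.val = k1 := by
      simp only [ZMod.val_natCast, Nat.mod_eq_of_lt hk1]
    rw [hv, sq, Nat.mod_eq_of_lt hk1, getIv_cosTab hk1]
    exact mem_imul (mem_imul (H.memF hk1 hk2) (H.memF hk1 hk2)) (mem_cosIv H.hL3 hk1)
  have h := mem_idivn hs hLL
  have e : ∀ x : ℝ, x / ((((L : ℤ) * L : ℤ)) : ℝ) = x / (L : ℝ) ^ 2 := by intro x; push_cast; ring
  rw [e] at h
  exact h

/-- ★ `⟨Π⁰, C0⟩ ∈ O.Q`. [folklore] -/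
theorem mem_objQ : mem (∑ c : Cfg L, piR L f c * C0fn L Δ lam2 f c) (xbEval L la lb).2.Q := by
  have hL0 : 0 < L := by have := H.hL; omega
  show mem _ (ineg (idivn (iscale 3 (sumN2F L (xbScal L la lb (gresCellTab L (cosTab L) la lb)) (gresCellTab L (cosTab L) la lb) (tTab L (gresCellTab L (cosTab L) la lb)) (fTabX L (xbScal L la lb (gresCellTab L (cosTab L) la lb)) (gresCellTab L (cosTab L) la lb) (tTab L (gresCellTab L (cosTab L) la lb))) (cosTab L) (cosTab (4 * L)))) (2 * ((L : ℤ) * L))))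
  rw [piC0OneLoop_holds L Δ lam2 f H.hf.1 H.hev, nnList_sum_range, ← Finset.sum_div]
  simp_rw [sum_tor_range]
  have hLL : (0 : ℤ) < 2 * ((L : ℤ) * L) := by
    have : (0 : ℤ) < L := by exact_mod_cast hL0
    positivity
  have hs : mem (∑ j ∈ range 4, ∑ i ∈ range L, ∑ j' ∈ range L,
      Complex.normSq (phiHat L f (eDir L j) ((((i : ℕ) : ZMod L), ((j' : ℕ) : ZMod L))))
        * F2 L f ((((i : ℕ) : ZMod L), ((j' : ℕ) : ZMod L))))
      (sumN2F L (xbScal L la lb (gresCellTab L (cosTab L) la lb)) (gresCellTab L (cosTab L) la lb) (tTab L (gresCellTab L (cosTab L) la lb)) (fTabX L (xbScal L la lb (gresCellTab L (cosTab L) la lb)) (gresCellTab L (cosTab L) la lb) (tTab L (gresCellTab L (cosTab L) la lb))) (cosTab L) (cosTab (4 * L))) := by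
    unfold sumN2F
    refine mem_psum _ _ 4 fun j hj => mem_psum _ _ L fun k1 hk1 => mem_psum _ _ L fun k2 hk2 => ?_
    exact mem_imul (mem_n2Of (H.discOK hj hk1 hk2)) (H.memF hk1 hk2)
  have h := mem_ineg (mem_idivn (mem_iscale 3 hs) hLL)
  have e : ∀ x : ℝ, -(((3 : ℕ) : ℝ) * x / (((2 * ((L : ℤ) * L) : ℤ)) : ℝ)) = -(3 / 2) * (x / (L : ℝ) ^ 2) := by
    intro x; push_cast; ring
  rw [e] at h
  exact h

/-- ★ `B_C ∈ O.C`. [folklore] -/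
theorem mem_objC : mem (BCterm L Δ lam2 f) (xbEval L la lb).2.C := by
  have hL0 : 0 < L := by have := H.hL; omega
  show mem _ (ineg (idivn (iscale 3 (sumJ L (xbScal L la lb (gresCellTab L (cosTab L) la lb)) (gresCellTab L (cosTab L) la lb) (tTab L (gresCellTab L (cosTab L) la lb)) (fTabX L (xbScal L la lb (gresCellTab L (cosTab L) la lb)) (gresCellTab L (cosTab L) la lb) (tTab L (gresCellTab L (cosTab L) la lb))) (cosTab L) (cosTab (4 * L)))) ((L : ℤ) * L)))
  rw [bcOneLoop_holds L Δ lam2 f H.hf.1 H.hev, nnList_sum_range, ← Finset.sum_div]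
  simp_rw [sum_tor_range]
  have hLL : (0 : ℤ) < (L : ℤ) * L := by
    have : (0 : ℤ) < L := by exact_mod_cast hL0
    positivity
  have hs : mem (∑ j ∈ range 4, ∑ i ∈ range L, ∑ j' ∈ range L,
      ((((starRingEnd ℂ) (phiHat L f (eDir L j) ((((i : ℕ) : ZMod L), ((j' : ℕ) : ZMod L)) : Tor L)) * phiHat L f (eDir L j) (((((i : ℕ) : ZMod L), ((j' : ℕ) : ZMod L)) : Tor L) + K1 L)).re
          * (F2 L f ((((i : ℕ) : ZMod L), ((j' : ℕ) : ZMod L)) : Tor L) + F2 L f (((((i : ℕ) : ZMod L), ((j' : ℕ) : ZMod L)) : Tor L) + K1 L))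
        + Complex.normSq (phiHat L f (eDir L j) ((((i : ℕ) : ZMod L), ((j' : ℕ) : ZMod L)) : Tor L)) * F2 L f (((((i : ℕ) : ZMod L), ((j' : ℕ) : ZMod L)) : Tor L) + K1 L))))
      (sumJ L (xbScal L la lb (gresCellTab L (cosTab L) la lb)) (gresCellTab L (cosTab L) la lb) (tTab L (gresCellTab L (cosTab L) la lb)) (fTabX L (xbScal L la lb (gresCellTab L (cosTab L) la lb)) (gresCellTab L (cosTab L) la lb) (tTab L (gresCellTab L (cosTab L) la lb))) (cosTab L) (cosTab (4 * L))) := by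
    unfold sumJ
    refine mem_psum _ _ 4 fun j hj => mem_psum _ _ L fun k1 hk1 => mem_psum _ _ L fun k2 hk2 => ?_
    have hk1' : (k1 + 1) % L < L := Nat.mod_lt _ hL0
    rw [natPair_add_K1]
    exact mem_iadd
      (mem_imul (mem_crossOf (H.discOK hj hk1 hk2) (H.discOK hj hk1' hk2)) (mem_iadd (H.memF hk1 hk2) (H.memF hk1' hk2)))
      (mem_imul (mem_n2Of (H.discOK hj hk1 hk2)) (H.memF hk1' hk2))
  have h := mem_ineg (mem_idivn (mem_iscale 3 hs) hLL)
  have e : ∀ x : ℝ, -(((3 : ℕ) : ℝ) * x / ((((L : ℤ) * L : ℤ)) : ℝ)) = -3 * (x / (L : ℝ) ^ 2) := by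
    intro x; push_cast; ring
  rw [e] at h
  exact h

end CellHyp

/-! ## The fixed-point `N₁⁻` and `T⁺⁺` -/

/-- one corner: `corner q b p / D ≤ −((q/D)(b/D)/(p/D))` for `p > 0`. [folklore] -/
theorem corner_le {q b p : ℤ} (hp : 0 < p) :
    ((corner q b p : ℤ) : ℝ)
      ≤ -(((q : ℝ) / ((D : ℤ) : ℝ)) * ((b : ℝ) / ((D : ℤ) : ℝ)) / ((p : ℝ) / ((D : ℤ) : ℝ))) * ((D : ℤ) : ℝ) := by
  have h := mem_ineg (mem_imul (mem_imul (mem_ipt q) (mem_ipt b)) (mem_iinv (mem_ipt p) (by exact hp)))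
  rw [div_eq_mul_one_div _ ((p : ℝ) / _)]
  exact h.1

/-- ★ the cell certificate is sound for the row-`N₁` crux: `cmin · U ≤ N₁` for every ground profile of the cell. [folklore] -/
theorem xb_cell_sound (hL : 5 ≤ L) {Δ lam2 : ℝ} (hΔ0 : 0 ≤ Δ) (hΔ1 : Δ < 1) {f : Tor L → ℝ}
    (hf : IsGroundTwoMagnon L Δ lam2 f) {la lb : ℤ}
    (hla : (la : ℝ) ≤ lam2 * ((D : ℤ) : ℝ)) (hlb : lam2 * ((D : ℤ) : ℝ) ≤ (lb : ℝ))
    {cmin : ℚ} (hcert : xbCellOK L la lb cmin = true) :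
    (cmin : ℝ) * Uunit L Δ f ≤ trialGapN1 L Δ f := by
  -- unpack the certificate
  simp only [xbCellOK, Bool.and_eq_true, decide_eq_true_eq] at hcert
  obtain ⟨⟨⟨⟨hchk, hsc⟩, hP⟩, hc0⟩, hineq⟩ := hcert
  have H : CellHyp (L := L) Δ lam2 f la lb := ⟨hL, hΔ0, hΔ1, hf, hla, hlb, hchk, hsc⟩
  have hD := D_pos
  set S := (xbEval L la lb).1 with hSdef
  set O := (xbEval L la lb).2 with hOdef
  have hS : ScalOK L Δ lam2 f S := H.hS
  have mB := H.mem_objB; have mP := H.mem_objP; have mA := H.mem_objA; have mQ := H.mem_objQ; have mC := H.mem_objC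
  rw [← hOdef] at mB mP mA mQ mC
  obtain ⟨mlam, -, ma, -, mfnn, -, -, -, -, -, meps⟩ := hS
  -- the real bracket ends
  set Blo : ℝ := (O.B.1 : ℝ) / ((D : ℤ) : ℝ)
  set Bhi : ℝ := (O.B.2 : ℝ) / ((D : ℤ) : ℝ)
  set Plo : ℝ := (O.P.1 : ℝ) / ((D : ℤ) : ℝ)
  set Phi : ℝ := (O.P.2 : ℝ) / ((D : ℤ) : ℝ)
  set Ahi : ℝ := (O.A.2 : ℝ) / ((D : ℤ) : ℝ)
  set Qlo : ℝ := (O.Q.1 : ℝ) / ((D : ℤ) : ℝ)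
  set Qhi : ℝ := (O.Q.2 : ℝ) / ((D : ℤ) : ℝ)
  set Clo : ℝ := (O.C.1 : ℝ) / ((D : ℤ) : ℝ)
  have hB1 : Blo ≤ Bterm L f := by rw [div_le_iff₀ hD]; exact mB.1
  have hB2 : Bterm L f ≤ Bhi := by rw [le_div_iff₀ hD]; exact mB.2
  have hP1 : Plo ≤ PiNormSq L f := by rw [div_le_iff₀ hD]; exact mP.1
  have hP2 : PiNormSq L f ≤ Phi := by rw [le_div_iff₀ hD]; exact mP.2
  have hA : Axhat L f ≤ Ahi := by rw [le_div_iff₀ hD]; exact mA.2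
  have hQ1 : Qlo ≤ ∑ c : Cfg L, piR L f c * C0fn L Δ lam2 f c := by rw [div_le_iff₀ hD]; exact mQ.1
  have hQ2 : ∑ c : Cfg L, piR L f c * C0fn L Δ lam2 f c ≤ Qhi := by rw [le_div_iff₀ hD]; exact mQ.2
  have hC : Clo ≤ BCterm L Δ lam2 f := by rw [div_le_iff₀ hD]; exact mC.1
  have hPlo : 0 < Plo := by
    have : (0 : ℝ) < (O.P.1 : ℝ) := by exact_mod_cast hP
    positivity
  have hP2pos : 0 < O.P.2 := by
    have : (O.P.1 : ℝ) ≤ (O.P.2 : ℝ) := mP.1.trans mP.2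
    have : O.P.1 ≤ O.P.2 := by exact_mod_cast this
    omega
  -- p1's lower bound
  have hN1 := KT1Assembly.n1_ge_pieces L H.hL3 hΔ0 hf H.hlam hB1 hB2 hPlo hP1 hP2 hA hQ1 hQ2 hC
  -- `n1Lo/D ≤` that expression
  have hLo : ((n1Lo S O : ℤ) : ℝ) ≤
      (-(eps1 L) * Bhi
        + min (min (min (-(Qlo * Blo / Plo)) (-(Qlo * Blo / Phi))) (min (-(Qlo * Bhi / Plo)) (-(Qlo * Bhi / Phi))))
              (min (min (-(Qhi * Blo / Plo)) (-(Qhi * Blo / Phi))) (min (-(Qhi * Bhi / Plo)) (-(Qhi * Bhi / Phi))))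
        - eps1 L / 2 * (3 * lam2 * Phi + Qhi + 12 * Δ * f (K1 L) ^ 2 * Ahi) + Clo) * ((D : ℤ) : ℝ) := by
    -- term 1
    have t1 := (mem_imul (mem_ineg meps) (mem_ipt O.B.2)).1
    -- corners
    have c1 := corner_le (q := O.Q.1) (b := O.B.1) hP
    have c2 := corner_le (q := O.Q.1) (b := O.B.1) hP2pos
    have c3 := corner_le (q := O.Q.1) (b := O.B.2) hP
    have c4 := corner_le (q := O.Q.1) (b := O.B.2) hP2pos
    have c5 := corner_le (q := O.Q.2) (b := O.B.1) hP
    have c6 := corner_le (q := O.Q.2) (b := O.B.1) hP2pos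
    have c7 := corner_le (q := O.Q.2) (b := O.B.2) hP
    have c8 := corner_le (q := O.Q.2) (b := O.B.2) hP2pos
    have tmin : ((minCorner O : ℤ) : ℝ) ≤
        min (min (min (-(Qlo * Blo / Plo)) (-(Qlo * Blo / Phi))) (min (-(Qlo * Bhi / Plo)) (-(Qlo * Bhi / Phi))))
            (min (min (-(Qhi * Blo / Plo)) (-(Qhi * Blo / Phi))) (min (-(Qhi * Bhi / Plo)) (-(Qhi * Bhi / Phi))))
          * ((D : ℤ) : ℝ) := by
      unfold minCorner
      push_cast
      simp only [min_mul_of_nonneg _ _ hD.le]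
      exact min_le_min (min_le_min (min_le_min c1 c2) (min_le_min c3 c4)) (min_le_min (min_le_min c5 c6) (min_le_min c7 c8))
    -- term 3
    have hX := mem_iadd (mem_iadd (mem_iscale 3 (mem_imul mlam (mem_ipt O.P.2))) (mem_ipt O.Q.2))
      (mem_iscale 12 (mem_imul (mem_imul ma mfnn) (mem_ipt O.A.2)))
    have t3 := (mem_ineg (mem_imul (mem_idivn meps (by norm_num : (0:ℤ) < 2)) hX)).1
    -- term 4
    have t4 : ((O.C.1 : ℤ) : ℝ) = Clo * ((D : ℤ) : ℝ) := by rw [div_mul_cancel₀ _ (ne_of_gt hD)]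
    unfold n1Lo
    push_cast
    push_cast at t1 t3
    have e3 : -(eps1 L / 2 * (3 * (lam2 * Phi) + Qhi + 12 * (Δ * f (K1 L) * f (K1 L) * Ahi)))
        = -(eps1 L / 2 * (3 * lam2 * Phi + Qhi + 12 * Δ * f (K1 L) ^ 2 * Ahi)) := by ring
    rw [e3] at t3
    nlinarith [t1, tmin, t3, t4]
  -- `T⁺ ≤ tPlusHi/D`
  have hT := (KT1Assembly.Tplus_bracket L hf.1 hPlo hP1 hP2 hQ1 hQ2).2
  have hThi : Tplus L Δ f * ((D : ℤ) : ℝ) ≤ ((tPlusHi S O : ℤ) : ℝ) := by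
    have u1 := (mem_iscale 3 mlam).2
    have u2 := (mem_imul (mem_ipt O.Q.2) (mem_iinv (mem_ipt O.P.1) (by exact hP))).2
    have u3 := (mem_imul (mem_ipt O.Q.2) (mem_iinv (mem_ipt O.P.2) (by exact hP2pos))).2
    unfold tPlusHi
    push_cast
    push_cast at u1 u2 u3
    rw [← div_eq_mul_one_div] at u2 u3
    have hmax : max (Qhi / Plo) (Qhi / Phi) * ((D : ℤ) : ℝ)
        ≤ max (((imul (ipt O.Q.2) (iinv (ipt O.P.1))).2 : ℤ) : ℝ) (((imul (ipt O.Q.2) (iinv (ipt O.P.2))).2 : ℤ) : ℝ) := by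
      rw [max_mul_of_nonneg _ _ hD.le]
      exact max_le_max u2 u3
    nlinarith [hmax, u1, hT]
  -- assemble
  have hV : (0 : ℝ) ≤ 3 * ((L : ℝ) ^ 2) ^ 2 := by positivity
  have hc0R : (0 : ℝ) ≤ (cmin : ℝ) := by exact_mod_cast hc0
  have hineqR : (cmin : ℝ) * (((3 * ((L : ℤ) * L) ^ 2 * tPlusHi S O : ℤ)) : ℝ) ≤ ((n1Lo S O : ℤ) : ℝ) := by
    exact_mod_cast hineq
  have hU : Uunit L Δ f * ((D : ℤ) : ℝ) ≤ (((3 * ((L : ℤ) * L) ^ 2 * tPlusHi S O : ℤ)) : ℝ) := by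
    unfold Uunit
    push_cast
    have : 3 * ((L : ℝ) ^ 2) ^ 2 * Tplus L Δ f * ((D : ℤ) : ℝ) = 3 * ((L : ℝ) ^ 2) ^ 2 * (Tplus L Δ f * ((D : ℤ) : ℝ)) := by
      ring
    rw [this]
    have h2 := mul_le_mul_of_nonneg_left hThi hV
    calc 3 * ((L : ℝ) ^ 2) ^ 2 * (Tplus L Δ f * ((D : ℤ) : ℝ)) ≤ 3 * ((L : ℝ) ^ 2) ^ 2 * ((tPlusHi S O : ℤ) : ℝ) := h2
      _ = 3 * ((L : ℝ) * L) ^ 2 * ((tPlusHi S O : ℤ) : ℝ) := by ring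
  -- `cmin·U·D ≤ n1Lo ≤ (…)·D ≤ N₁·D`
  have h1 : (cmin : ℝ) * Uunit L Δ f * ((D : ℤ) : ℝ) ≤ ((n1Lo S O : ℤ) : ℝ) := by
    have := mul_le_mul_of_nonneg_left hU hc0R
    linarith
  have h2 : ((n1Lo S O : ℤ) : ℝ) ≤ trialGapN1 L Δ f * ((D : ℤ) : ℝ) := hLo.trans (mul_le_mul_of_nonneg_right hN1 hD.le)
  exact le_of_mul_le_mul_right (h1.trans h2) hD

end FinXB

end Summit.HubbardSuperconductivity.HubbardSuperconductivity.Theorems.AnisotropyChord.Transfer.Fibre3
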